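import Summits.ABC.ABC.Theses.DefiniteXi
import Summits.ABC.ABC.Theorems.DefiniteXiPolyFreyDegree
import Summits.ABC.ABC.Theorems.DefiniteXiXiBoundExponentProductFrey
import Summits.ABC.ABC.Theorems.RibetTakahashiSplitManyPrimeValuationProductBootstrap
import Literature.NumberTheory.EllipticCurves.PastenValuationProductThm75Proofs
import HarnessLib

/-!
# Crux `XiBound` (stmt-ABC-11336), line `two-adic-redei-depth` — stub 4c: the Szpiro bootstrap

Stub `stub_szpiroBootstrap`: the definite Ribet–Takahashi comparison at prime type
(`DefiniteRTControlPrime`), modularity of the Frey curves in datum form (`FreyModularity`) and the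
`δ`-WEAK `ξ`-bound `ξ(E_(a,b); N/N⁻, N⁻) ≤ C_δ N^A |Δ_min|^δ` (for every `δ > 0`) together give
polynomial Szpiro on the Frey–Hellegouarch curves `E_(a,b) : y² = x(x − a)(x + b)`:
`|Δ_min(E_(a,b))| ≤ C · N^κ` for absolute `κ, C`.

## Proof

* `abs_Δ_le_mul_deg_pow_six` — for EVERY Weierstrass model `W/ℚ` and every modular
  parametrisation datum `D` of `W` (any level): `|Δ_W| ≤ K₀ · (deg D)⁶` with an absolute `K₀`.
  Ingredients, all theorems of the tree: `|g₂³ − 27 g₃²|(Λ) · covol(Λ)⁶ ≤ e¹⁶` for every lattice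
  (`norm_discr_mul_covolume_pow_six_le`, Silverman 1986 Prop. 1.1 / Pasten 2024 Lemma 18.1),
  `g₂³ − 27g₃² = Δ_W` on a Néron-type lattice of `W` (`discr_eq_ratCast_Δ_of_isNeronLatticeOf`),
  Zagier's identity `covol(Λ) = 4π² c² (f,f) / deg` (`Pasten2024.covolume_eq_of_zagier`), the
  integrality `c ∈ ℤ ∖ {0}` of the Manin constant (`maninConstant_ne_zero_holds`) and the trivial
  Petersson bound `(f,f) ≥ e^{−4π}/(4π)` (`IsNewformOf.peterssonProduct_re_ge`).
* For the Frey model `Δ = 16 (ab(a+b))²` (`freyCurve_Δ`) and `|Δ_min| ≤ |Δ|` of any integral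
  model (`XiBoundExponentProduct.factorization_minimalDiscriminantNorm_le_int`), so
  `|Δ_min(E_(a,b))| ≤ K₀ (deg D)⁶` for every datum `D` of `E_(a,b)`.
* `minimalDegreeBound_delta` — if an odd prime `q ∣ N`, then `N⁻ := q` is admissible and for a
  MINIMAL-degree datum `D`: `deg D ≤ C₂ N ξ(N/q,q) v_q(Δ_min)` (`DefiniteRTControlPrime`, `ε = 1`),
  `ξ ≤ C₁ N^A |Δ_min|^δ` (hypothesis), `v_q(Δ_min) ≤ A_δ |Δ_min|^δ` (divisor-type bound,
  `ManyPrimeValuationProduct.prod_factorization_le_rpow`); so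
  `deg D ≤ K N^{A⁺+1} |Δ_min|^{2δ}`, `A⁺ = max(A,0)`.
* Bootstrap with `δ = 1/24`: `|Δ_min| ≤ K₀ K⁶ N^{6(A⁺+1)} |Δ_min|^{1/2}`, hence
  `|Δ_min| ≤ (K₀K⁶)² N^{12(A⁺+1)}` (a minimal datum exists by `FreyModularity` and well-ordering).
  If no odd prime divides `N`, then `|a|, |b| ≤ 2` (`prime_eq_two_of_dvd`, `natAbs_le_two`) and
  `|Δ_min| ≤ 16 (ab(a+b))² ≤ 4096`.
No new definitions, no named facts.

## References

* H. Pasten, *Shimura curves and the abc conjecture*, J. Number Theory 254 (2024),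
  arXiv:1705.09251, §3 (3.1)–(3.2). [PastenShimura2024]
* J. H. Silverman, *Heights and elliptic curves*, in: Arithmetic Geometry (1986), Prop. 1.1.
  [Silverman1986]
* G. Frey, *Links between solutions of A − B = C and elliptic curves*, LNM 1380 (1989).
-/

-- `Summit.<Summit>.<Problem>` is the mandated summit-side namespace (CONVENTIONS §2); for the
-- single-conjunct summit `ABC` the two coincide, so the duplicate `ABC.ABC` is deliberate.
set_option linter.dupNamespace false

noncomputable section

namespace Summit.ABC.ABC.Theorems

namespace XiBoundSzpiroBootstrap

open WeierstrassCurve CongruenceSubgroup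
open Literature.NumberTheory.Automorphic Literature.NumberTheory.EllipticCurves
open Literature.NumberTheory.EllipticCurves.ModularForms
open Summit.ABC.ABC.Theses.DefiniteXi

/-! ### Step 1: `|Δ_W| ≤ K₀ · (deg D)⁶` for every model and every datum -/

/-- **Zagier's identity with the trivial Petersson bound**: for every datum `D` of any model
`W/ℚ` at any level, `covol(Λ) = 4π² c² (f,f) / deg ≥ 4π² c₀ / deg` with `c₀ = e^{-4π}/(4π)`
(`Pasten2024.covolume_eq_of_zagier`, `c ∈ ℤ ∖ {0}` by `maninConstant_ne_zero_holds`,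
`(f,f) ≥ c₀` by `IsNewformOf.peterssonProduct_re_ge`). [cite: PastenShimura2024, §3 (3.2)] -/
theorem covolume_ge_of_datum (W : WeierstrassCurve ℚ) (N : ℕ) [NeZero N]
    (D : ModularParametrizationData W N) :
    4 * Real.pi ^ 2 * (Real.exp (-(4 * Real.pi)) / (4 * Real.pi)) / D.deg ≤
      ZLattice.covolume D.L.lattice := by
  have hc₀ : 0 < Real.exp (-(4 * Real.pi)) / (4 * Real.pi) := by positivity
  have hP : Real.exp (-(4 * Real.pi)) / (4 * Real.pi) ≤
      (peterssonProduct (Gamma0 N) 2 D.f D.f).re := D.isNewformOf.peterssonProduct_re_ge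
  have hcsq : (1 : ℝ) ≤ (D.c : ℝ) ^ 2 := by
    have h0 : D.c ≠ 0 := D.maninConstant_ne_zero_holds
    have h1 : (1 : ℤ) ≤ D.c ^ 2 := by nlinarith [Int.one_le_abs h0, sq_abs D.c]
    exact_mod_cast h1
  have hd : (0 : ℝ) < D.deg := by exact_mod_cast D.deg_pos
  rw [Pasten2024.covolume_eq_of_zagier D]
  apply div_le_div_of_nonneg_right _ hd.le
  have h1 : 1 * (Real.exp (-(4 * Real.pi)) / (4 * Real.pi)) ≤
      (D.c : ℝ) ^ 2 * (peterssonProduct (Gamma0 N) 2 D.f D.f).re :=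
    mul_le_mul hcsq hP hc₀.le (by positivity)
  have hπ : (0 : ℝ) ≤ 4 * Real.pi ^ 2 := by positivity
  calc 4 * Real.pi ^ 2 * (Real.exp (-(4 * Real.pi)) / (4 * Real.pi))
      = 4 * Real.pi ^ 2 * (1 * (Real.exp (-(4 * Real.pi)) / (4 * Real.pi))) := by ring
    _ ≤ 4 * Real.pi ^ 2 * ((D.c : ℝ) ^ 2 * (peterssonProduct (Gamma0 N) 2 D.f D.f).re) :=
        mul_le_mul_of_nonneg_left h1 hπ
    _ = _ := by ring

/-- **`|Δ_W| · covol(Λ)⁶ ≤ e¹⁶`** for every model `W/ℚ` and the lattice of every datum of `W`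
(`norm_discr_mul_covolume_pow_six_le` for every lattice, Silverman 1986 Prop. 1.1 / Pasten 2024
Lemma 18.1, and `g₂³ − 27g₃² = Δ_W` on a Néron-type lattice of `W`,
`discr_eq_ratCast_Δ_of_isNeronLatticeOf`; no minimality of `W` is needed).
[cite: PastenShimura2024, §3 (3.1) and Lemma 18.1] -/
theorem abs_Δ_mul_covolume_pow_six_le (W : WeierstrassCurve ℚ) (N : ℕ) [NeZero N]
    (D : ModularParametrizationData W N) :
    |((W.Δ : ℚ) : ℝ)| * ZLattice.covolume D.L.lattice ^ 6 ≤ Real.exp 16 := by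
  have key := norm_discr_mul_covolume_pow_six_le D.L
  rwa [discr_eq_ratCast_Δ_of_isNeronLatticeOf D.isNeronLattice, ← Complex.ofReal_ratCast,
    Complex.norm_real, Real.norm_eq_abs] at key

/-- Real bookkeeping: `x cov⁶ ≤ e`, `0 < low ≤ cov`, `e ≥ 0` give `x ≤ e / low⁶`. [folklore] -/
theorem le_div_pow_six {x cov low e : ℝ} (he : 0 ≤ e) (hcov : 0 < cov) (hlowpos : 0 < low)
    (hlow : low ≤ cov) (key : x * cov ^ 6 ≤ e) : x ≤ e / low ^ 6 := by
  have h6 : low ^ 6 ≤ cov ^ 6 := pow_le_pow_left₀ hlowpos.le hlow 6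
  have hΔ : x ≤ e / cov ^ 6 := by rw [le_div_iff₀ (pow_pos hcov 6)]; exact key
  exact hΔ.trans (div_le_div_of_nonneg_left he (pow_pos hlowpos 6) h6)

/-- **Polynomial Szpiro from the modular degree, any model.** There is an absolute `K₀ > 0` with
`|Δ_W| ≤ K₀ · (deg D)⁶` for every Weierstrass model `W/ℚ` and every modular parametrisation datum
`D` of `W` at any level `N`: `|Δ_W| covol(Λ)⁶ ≤ e¹⁶` and `covol(Λ) ≥ 4π² c₀/deg`.
[cite: PastenShimura2024, §3 (3.1)–(3.2)] -/
theorem abs_Δ_le_mul_deg_pow_six :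
    ∃ K₀ : ℝ, 0 < K₀ ∧ ∀ (W : WeierstrassCurve ℚ) (N : ℕ) [NeZero N]
      (D : ModularParametrizationData W N), |((W.Δ : ℚ) : ℝ)| ≤ K₀ * (D.deg : ℝ) ^ 6 := by
  have hc₀ : 0 < 4 * Real.pi ^ 2 * (Real.exp (-(4 * Real.pi)) / (4 * Real.pi)) := by positivity
  refine ⟨Real.exp 16 / (4 * Real.pi ^ 2 * (Real.exp (-(4 * Real.pi)) / (4 * Real.pi))) ^ 6,
    by positivity, fun W N _ D ↦ ?_⟩
  have hd : (0 : ℝ) < D.deg := by exact_mod_cast D.deg_pos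
  have h := le_div_pow_six (Real.exp_pos 16).le (ZLattice.covolume_pos _ _) (by positivity)
    (covolume_ge_of_datum W N D) (abs_Δ_mul_covolume_pow_six_le W N D)
  rwa [div_pow, div_div_eq_mul_div, mul_div_right_comm] at h

/-! ### Step 2: the Frey curve — `|Δ_min(E_(a,b))| ≤ 16 (ab(a+b))² = |Δ|` -/

/-- The minimal discriminant is at most the discriminant of any integral equation:
`|Δ_min(W₀ ⊗ ℚ)| ≤ |Δ(W₀)|` for `W₀ / ℤ` with `Δ(W₀) ≠ 0` (prime by prime,
`XiBoundExponentProduct.factorization_minimalDiscriminantNorm_le_int`; Silverman AEC VII.1).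
[folklore] -/
theorem minimalDiscriminantNorm_le_natAbs_Δ (W₀ : WeierstrassCurve ℤ) (hΔ : W₀.Δ ≠ 0) :
    (W₀.baseChange ℚ).minimalDiscriminantNorm ℤ ≤ W₀.Δ.natAbs := by
  refine Nat.le_of_dvd (Int.natAbs_pos.mpr hΔ) ((Nat.factorization_le_iff_dvd
    (minimalDiscriminantNorm_pos_holds _).ne' (Int.natAbs_ne_zero.mpr hΔ)).mp fun p ↦ ?_)
  by_cases hp : p.Prime
  · exact XiBoundExponentProduct.factorization_minimalDiscriminantNorm_le_int W₀ hΔ hp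
  · simp [Nat.factorization_eq_zero_of_not_prime _ hp]

/-- For the Frey curve with `ab(a+b) ≠ 0`: `|Δ_min(E_(a,b))| ≤ 16 (ab(a+b))²`, the discriminant of
the integral model `y² = x(x − a)(x + b)` (`freyIntModel_Δ`). [folklore] -/
theorem minimalDiscriminantNorm_freyCurve_le {a b : ℤ} (h0 : a * b * (a + b) ≠ 0) :
    (((freyCurve a b).minimalDiscriminantNorm ℤ : ℕ) : ℤ) ≤ 16 * (a * b * (a + b)) ^ 2 := by
  have hΔ' : (freyIntModel a b).Δ = 16 * (a * b * (a + b)) ^ 2 := freyIntModel_Δ a b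
  have hΔ : (freyIntModel a b).Δ ≠ 0 := by
    rw [hΔ']; exact mul_ne_zero (by norm_num) (pow_ne_zero 2 h0)
  have h1 : (freyCurve a b).minimalDiscriminantNorm ℤ ≤ (freyIntModel a b).Δ.natAbs := by
    rw [← baseChange_freyIntModel]; exact minimalDiscriminantNorm_le_natAbs_Δ _ hΔ
  have h2 : (((freyIntModel a b).Δ.natAbs : ℕ) : ℤ) = 16 * (a * b * (a + b)) ^ 2 := by
    rw [Int.natAbs_of_nonneg (by rw [hΔ']; positivity), hΔ']
  calc (((freyCurve a b).minimalDiscriminantNorm ℤ : ℕ) : ℤ)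
      ≤ (((freyIntModel a b).Δ.natAbs : ℕ) : ℤ) := by exact_mod_cast h1
    _ = _ := h2

/-- `|Δ(E_(a,b))| = 16 (ab(a+b))²` as a real number (`freyCurve_Δ`). [folklore] -/
theorem abs_cast_Δ_freyCurve (a b : ℤ) :
    |(((freyCurve a b).Δ : ℚ) : ℝ)| = ((16 * (a * b * (a + b)) ^ 2 : ℤ) : ℝ) := by
  rw [freyCurve_Δ]
  push_cast
  exact abs_of_nonneg (by positivity)

/-- **`|Δ_min(E_(a,b))| ≤ K₀ (deg D)⁶`** for every datum `D` of the Frey model at any level, given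
the conclusion of `abs_Δ_le_mul_deg_pow_six`. [folklore] -/
theorem cast_minimalDiscriminantNorm_freyCurve_le_deg {K₀ : ℝ}
    (hK₀ : ∀ (W : WeierstrassCurve ℚ) (N : ℕ) [NeZero N] (D : ModularParametrizationData W N),
      |((W.Δ : ℚ) : ℝ)| ≤ K₀ * (D.deg : ℝ) ^ 6)
    {a b : ℤ} (h0 : a * b * (a + b) ≠ 0) {N : ℕ} [NeZero N]
    (D : ModularParametrizationData (freyCurve a b) N) :
    (((freyCurve a b).minimalDiscriminantNorm ℤ : ℕ) : ℝ) ≤ K₀ * (D.deg : ℝ) ^ 6 :=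
  calc (((freyCurve a b).minimalDiscriminantNorm ℤ : ℕ) : ℝ)
      = ((((freyCurve a b).minimalDiscriminantNorm ℤ : ℕ) : ℤ) : ℝ) := by norm_cast
    _ ≤ ((16 * (a * b * (a + b)) ^ 2 : ℤ) : ℝ) := by
        exact_mod_cast minimalDiscriminantNorm_freyCurve_le h0
    _ = |(((freyCurve a b).Δ : ℚ) : ℝ)| := (abs_cast_Δ_freyCurve a b).symm
    _ ≤ K₀ * (D.deg : ℝ) ^ 6 := hK₀ _ N D

/-- The corner `|a|, |b| ≤ 2`: `16 (ab(a+b))² ≤ 4096`. [folklore] -/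
theorem sixteen_mul_sq_le {a b : ℤ} (ha : a.natAbs ≤ 2) (hb : b.natAbs ≤ 2) :
    (16 * (a * b * (a + b)) ^ 2 : ℤ) ≤ 4096 := by
  have h : -2 ≤ a ∧ a ≤ 2 ∧ -2 ≤ b ∧ b ≤ 2 := by omega
  obtain ⟨ha1, ha2, hb1, hb2⟩ := h
  interval_cases a <;> interval_cases b <;> norm_num

/-! ### Step 3: arithmetic helpers -/

/-- A single exponent of a factorisation is sub-polynomial: for `δ > 0` there is `A > 0` with
`v_q(n) ≤ A · n^δ` for all `n ≠ 0` and all `q`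
(`ManyPrimeValuationProduct.prod_factorization_le_rpow` with `S = {q}`). [folklore] -/
theorem factorization_le_rpow {δ : ℝ} (hδ : 0 < δ) :
    ∃ A : ℝ, 0 < A ∧ ∀ n q : ℕ, n ≠ 0 → ((n.factorization q : ℕ) : ℝ) ≤ A * (n : ℝ) ^ δ := by
  obtain ⟨A, hA, h⟩ := ManyPrimeValuationProduct.prod_factorization_le_rpow hδ
  refine ⟨A, hA, fun n q hn ↦ ?_⟩
  by_cases hq : q ∈ n.primeFactors
  · simpa using h n hn {q} (Finset.singleton_subset_iff.mpr hq)
  · have hq0 : n.factorization q = 0 :=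
      Finsupp.notMem_support_iff.mp (by rwa [Nat.support_factorization])
    rw [hq0, Nat.cast_zero]
    positivity

/-- Self-improvement: `0 ≤ x ≤ B · x^{1/2}` with `B ≥ 0` forces `x ≤ B²`. [folklore] -/
theorem le_sq_of_le_mul_rpow_half {x B : ℝ} (hx : 0 ≤ x) (hB : 0 ≤ B)
    (h : x ≤ B * x ^ (1 / 2 : ℝ)) : x ≤ B ^ 2 := by
  rw [← Real.sqrt_eq_rpow x] at h
  have hsx : Real.sqrt x * Real.sqrt x = x := Real.mul_self_sqrt hx
  rcases eq_or_lt_of_le (Real.sqrt_nonneg x) with h0 | hpos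
  · have hx0 : x = 0 := by rw [← hsx, ← h0]; ring
    rw [hx0]; positivity
  · have h1 : Real.sqrt x ≤ B := by
      have h2 : Real.sqrt x * Real.sqrt x ≤ B * Real.sqrt x := by rw [hsx]; exact h
      exact le_of_mul_le_mul_right h2 hpos
    calc x = Real.sqrt x * Real.sqrt x := hsx.symm
      _ ≤ B * B := mul_le_mul h1 h1 (Real.sqrt_nonneg x) hB
      _ = B ^ 2 := (sq B).symm

/-! ### Step 4: the degree bound with a `|Δ_min|^{2δ}` factor -/

/-- **Degree bound at an odd prime, `δ`-weak form.** From `DefiniteRTControlPrime` and the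
`δ`-weak `ξ`-bound `ξ(E_(a,b); N/N⁻, N⁻) ≤ C_δ N^A |Δ_min|^δ`: for every `δ > 0` there is `K > 0`
such that for coprime `a, b` with `ab(a+b) ≠ 0`, `N` the conductor, an odd prime `q ∣ N` and a
MINIMAL-degree datum `D` of `E_(a,b)` at level `N`,
`deg D ≤ K · N^{max(A,0)+1} · |Δ_min|^{2δ}` — `N⁻ := q` is admissible (odd, squarefree, one prime
factor), `deg D ≤ C₂ N ξ(N/q,q) v_q(Δ_min)` (`ε := 1`), `v_q(Δ_min) ≤ A_δ |Δ_min|^δ`. [folklore] -/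
theorem minimalDegreeBound_delta (hRT : DefiniteRTControlPrime) {A : ℝ}
    (hXi : ∀ δ : ℝ, 0 < δ → ∃ C : ℝ, ∀ a b : ℤ, IsCoprime a b → a * b * (a + b) ≠ 0 →
      ∀ (N : ℕ) [NeZero N], (freyCurve a b).conductorNorm ℤ = N →
      ∀ Nm : ℕ, Odd Nm → Squarefree Nm → Odd Nm.primeFactors.card → Nm ∣ N →
      (brandtXi (N / Nm) Nm (fun n => (freyCurve a b).LFunction n) : ℝ) ≤
        C * (N : ℝ) ^ A * (((freyCurve a b).minimalDiscriminantNorm ℤ : ℕ) : ℝ) ^ δ)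
    {δ : ℝ} (hδ : 0 < δ) :
    ∃ K : ℝ, 0 < K ∧ ∀ a b : ℤ, IsCoprime a b → a * b * (a + b) ≠ 0 →
      ∀ (N : ℕ) [NeZero N], (freyCurve a b).conductorNorm ℤ = N →
      ∀ q : ℕ, q.Prime → q ≠ 2 → q ∣ N →
      ∀ D : ModularParametrizationData (freyCurve a b) N,
        (∀ D' : ModularParametrizationData (freyCurve a b) N, D.deg ≤ D'.deg) →
          (D.deg : ℝ) ≤ K * (N : ℝ) ^ (max A 0 + 1) *
            (((freyCurve a b).minimalDiscriminantNorm ℤ : ℕ) : ℝ) ^ (2 * δ) := by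
  obtain ⟨C₂, hC₂⟩ := hRT 1 one_pos
  obtain ⟨C₁, hC₁⟩ := hXi δ hδ
  obtain ⟨A₃, hA₃, h₃⟩ := factorization_le_rpow hδ
  refine ⟨max C₂ 1 * max C₁ 1 * A₃, by positivity,
    fun a b hab h0 N _ hN q hq hq2 hqN D hmin ↦ ?_⟩
  have hN1 : (1 : ℝ) ≤ (N : ℝ) := Nat.one_le_cast.mpr (Nat.one_le_iff_ne_zero.mpr (NeZero.ne N))
  have hN0 : (0 : ℝ) ≤ (N : ℝ) := Nat.cast_nonneg N
  have hNpos : (0 : ℝ) < (N : ℝ) := one_pos.trans_le hN1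
  have hΔpos : 0 < (freyCurve a b).minimalDiscriminantNorm ℤ := minimalDiscriminantNorm_pos_holds _
  have h1 := hC₂ a b hab h0 N hN q hq hq2 hqN D hmin
  have h2 := hC₁ a b hab h0 N hN q (hq.odd_of_ne_two hq2) hq.prime.squarefree
    (by rw [hq.primeFactors, Finset.card_singleton]; exact odd_one) hqN
  have h3 := h₃ _ q hΔpos.ne'
  set Δm : ℕ := (freyCurve a b).minimalDiscriminantNorm ℤ with hΔm
  set X : ℝ := (brandtXi (N / q) q (fun n => (freyCurve a b).LFunction n) : ℝ) with hX
  set Y : ℝ := ((Δm.factorization q : ℕ) : ℝ) with hY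
  have hΔ0 : (0 : ℝ) ≤ (Δm : ℝ) := Nat.cast_nonneg _
  have hX0 : 0 ≤ X := Nat.cast_nonneg _
  have hY0 : 0 ≤ Y := Nat.cast_nonneg _
  have hNA : (0 : ℝ) ≤ (N : ℝ) ^ A := Real.rpow_nonneg hN0 _
  have hΔδ : (0 : ℝ) ≤ (Δm : ℝ) ^ δ := Real.rpow_nonneg hΔ0 _
  have hX' : X ≤ max C₁ 1 * (N : ℝ) ^ (max A 0) * (Δm : ℝ) ^ δ :=
    calc X ≤ C₁ * (N : ℝ) ^ A * (Δm : ℝ) ^ δ := h2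
      _ ≤ max C₁ 1 * (N : ℝ) ^ A * (Δm : ℝ) ^ δ :=
          mul_le_mul_of_nonneg_right (mul_le_mul_of_nonneg_right (le_max_left _ _) hNA) hΔδ
      _ ≤ max C₁ 1 * (N : ℝ) ^ (max A 0) * (Δm : ℝ) ^ δ :=
          mul_le_mul_of_nonneg_right (mul_le_mul_of_nonneg_left
            (Real.rpow_le_rpow_of_exponent_le hN1 (le_max_left _ _))
            (zero_le_one.trans (le_max_right _ _))) hΔδ
  have hY' : Y ≤ A₃ * (Δm : ℝ) ^ δ := h3
  have hXY : X * Y ≤ (max C₁ 1 * (N : ℝ) ^ (max A 0) * (Δm : ℝ) ^ δ) * (A₃ * (Δm : ℝ) ^ δ) :=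
    mul_le_mul hX' hY' hY0 (hX0.trans hX')
  have hN1' : (N : ℝ) ^ (1 : ℝ) = N := Real.rpow_one _
  calc (D.deg : ℝ) ≤ C₂ * (N : ℝ) ^ (1 : ℝ) * (X * Y) := h1
    _ = C₂ * N * (X * Y) := by rw [hN1']
    _ ≤ max C₂ 1 * N * (X * Y) :=
        mul_le_mul_of_nonneg_right (mul_le_mul_of_nonneg_right (le_max_left _ _) hN0)
          (mul_nonneg hX0 hY0)
    _ ≤ max C₂ 1 * N * ((max C₁ 1 * (N : ℝ) ^ (max A 0) * (Δm : ℝ) ^ δ) * (A₃ * (Δm : ℝ) ^ δ)) :=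
        mul_le_mul_of_nonneg_left hXY (mul_nonneg (zero_le_one.trans (le_max_right _ _)) hN0)
    _ = max C₂ 1 * max C₁ 1 * A₃ * ((N : ℝ) ^ (max A 0) * N) * ((Δm : ℝ) ^ δ * (Δm : ℝ) ^ δ) := by
        ring
    _ = max C₂ 1 * max C₁ 1 * A₃ * (N : ℝ) ^ (max A 0 + 1) * (Δm : ℝ) ^ (2 * δ) := by
        rw [← Real.rpow_add_one (NeZero.ne (N : ℝ)), ← Real.rpow_add' hΔ0 (by positivity),
          show δ + δ = 2 * δ by ring]

end XiBoundSzpiroBootstrap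

open Literature.NumberTheory.Automorphic Literature.NumberTheory.EllipticCurves
open Literature.NumberTheory.EllipticCurves.ModularForms
open Summit.ABC.ABC.Theses.DefiniteXi
open XiBoundSzpiroBootstrap

/-- **The Szpiro bootstrap** (stub 4c of line `two-adic-redei-depth`, crux `XiBound`,
stmt-ABC-11336). The definite Ribet–Takahashi comparison at prime type, modularity of the Frey
curves in datum form, and the `δ`-weak bound `ξ(E_(a,b); N/N⁻, N⁻) ≤ C_δ N^A |Δ_min|^δ` (all
`δ > 0`, all admissible `N⁻`) give polynomial Szpiro on Frey curves:
`|Δ_min(E_(a,b))| ≤ C N^κ` with `κ = 12 (max(A,0) + 1)`. Proof: with `δ = 1/24` and an odd prime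
`q ∣ N`, a minimal datum `D` has `deg D ≤ K N^{max(A,0)+1} |Δ_min|^{1/12}`
(`minimalDegreeBound_delta`), while `|Δ_min| ≤ |Δ(E_(a,b))| ≤ K₀ (deg D)⁶` (Zagier's identity,
`c ∈ ℤ ∖ {0}`, the trivial Petersson bound and `|Δ_W| covol⁶ ≤ e¹⁶`:
`cast_minimalDiscriminantNorm_freyCurve_le_deg`); so `|Δ_min| ≤ K₀K⁶ N^{6(max(A,0)+1)} |Δ_min|^{1/2}`
and `|Δ_min| ≤ (K₀K⁶)² N^κ`. If `N` has no odd prime factor, `|a|, |b| ≤ 2` and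
`|Δ_min| ≤ 16(ab(a+b))² ≤ 4096`. [cite: PastenShimura2024, §3 (3.1)–(3.2)] -/
theorem stub_szpiroBootstrap :
    Summit.ABC.ABC.Theses.DefiniteXi.DefiniteRTControlPrime →
    Summit.ABC.ABC.Theses.DefiniteXi.FreyModularity →
    (∃ A : ℝ, ∀ δ : ℝ, 0 < δ → ∃ C : ℝ, ∀ a b : ℤ, IsCoprime a b → a * b * (a + b) ≠ 0 →
      ∀ (N : ℕ) [NeZero N], (freyCurve a b).conductorNorm ℤ = N →
      ∀ Nm : ℕ, Odd Nm → Squarefree Nm → Odd Nm.primeFactors.card → Nm ∣ N →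
      (brandtXi (N / Nm) Nm (fun n => (freyCurve a b).LFunction n) : ℝ) ≤
        C * (N : ℝ) ^ A * (((freyCurve a b).minimalDiscriminantNorm ℤ : ℕ) : ℝ) ^ δ) →
    ∃ κ C : ℝ, ∀ a b : ℤ, IsCoprime a b → a * b * (a + b) ≠ 0 →
      ∀ (N : ℕ) [NeZero N], (freyCurve a b).conductorNorm ℤ = N →
      (((freyCurve a b).minimalDiscriminantNorm ℤ : ℕ) : ℝ) ≤ C * (N : ℝ) ^ κ := by
  rintro hRT hMod ⟨A, hXi⟩
  obtain ⟨K₀, hK₀, hK₀b⟩ := abs_Δ_le_mul_deg_pow_six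
  obtain ⟨K, hK, hKb⟩ := minimalDegreeBound_delta hRT hXi (δ := 1 / 24) (by norm_num)
  set A' : ℝ := max A 0 + 1 with hA'
  have hA'0 : 0 ≤ A' := by positivity
  set M : ℝ := K₀ * K ^ 6 with hM
  have hM0 : 0 ≤ M := by positivity
  refine ⟨12 * A', M ^ 2 + 4096, fun a b hab h0 N _ hN ↦ ?_⟩
  have hN1 : (1 : ℝ) ≤ (N : ℝ) := Nat.one_le_cast.mpr (Nat.one_le_iff_ne_zero.mpr (NeZero.ne N))
  have hN0 : (0 : ℝ) ≤ (N : ℝ) := Nat.cast_nonneg N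
  have hNκ1 : (1 : ℝ) ≤ (N : ℝ) ^ (12 * A') := Real.one_le_rpow hN1 (by positivity)
  have hΔ0 : (0 : ℝ) ≤ (((freyCurve a b).minimalDiscriminantNorm ℤ : ℕ) : ℝ) := Nat.cast_nonneg _
  by_cases hodd : ∃ q : ℕ, q.Prime ∧ q ≠ 2 ∧ q ∣ N
  · -- MAIN CASE: an odd prime `q ∣ N`
    obtain ⟨q, hq, hq2, hqN⟩ := hodd
    obtain ⟨D, hmin⟩ := DefiniteXiPolyFreyDegree.exists_minimal_datum (hMod a b hab h0 N hN)
    have hdeg := hKb a b hab h0 N hN q hq hq2 hqN D hmin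
    have hΔle := cast_minimalDiscriminantNorm_freyCurve_le_deg hK₀b h0 D
    set Δm : ℝ := (((freyCurve a b).minimalDiscriminantNorm ℤ : ℕ) : ℝ) with hΔm
    have hexp : ((Δm : ℝ) ^ (2 * (1 / 24) : ℝ)) ^ 6 = Δm ^ (1 / 2 : ℝ) := by
      rw [← Real.rpow_natCast, ← Real.rpow_mul hΔ0]; norm_num
    have hNexp : ((N : ℝ) ^ A') ^ 6 = (N : ℝ) ^ (6 * A') := by
      rw [← Real.rpow_natCast, ← Real.rpow_mul hN0, mul_comm]; norm_num
    have hrhs0 : 0 ≤ K * (N : ℝ) ^ A' * Δm ^ (2 * (1 / 24) : ℝ) := by positivity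
    have hmain : Δm ≤ M * (N : ℝ) ^ (6 * A') * Δm ^ (1 / 2 : ℝ) :=
      calc Δm ≤ K₀ * (D.deg : ℝ) ^ 6 := hΔle
        _ ≤ K₀ * (K * (N : ℝ) ^ A' * Δm ^ (2 * (1 / 24) : ℝ)) ^ 6 :=
            mul_le_mul_of_nonneg_left (pow_le_pow_left₀ (Nat.cast_nonneg _) hdeg 6) hK₀.le
        _ = K₀ * K ^ 6 * ((N : ℝ) ^ A') ^ 6 * (Δm ^ (2 * (1 / 24) : ℝ)) ^ 6 := by ring
        _ = M * (N : ℝ) ^ (6 * A') * Δm ^ (1 / 2 : ℝ) := by rw [hexp, hNexp]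
    have hB : 0 ≤ M * (N : ℝ) ^ (6 * A') := by positivity
    have hsq := le_sq_of_le_mul_rpow_half hΔ0 hB hmain
    have hN2 : ((N : ℝ) ^ (6 * A')) ^ 2 = (N : ℝ) ^ (12 * A') := by
      rw [← Real.rpow_natCast, ← Real.rpow_mul hN0]; ring_nf
    calc Δm ≤ (M * (N : ℝ) ^ (6 * A')) ^ 2 := hsq
      _ = M ^ 2 * (N : ℝ) ^ (12 * A') := by rw [mul_pow, hN2]
      _ ≤ (M ^ 2 + 4096) * (N : ℝ) ^ (12 * A') :=
          mul_le_mul_of_nonneg_right (by norm_num) (zero_le_one.trans hNκ1)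
  · -- CORNER: `N` has no odd prime factor; `|a|, |b| ≤ 2`
    push Not at hodd
    have hno : ∀ q : ℕ, q.Prime → q ∣ N → q = 2 := fun q hq hqN ↦ by
      by_contra hq2
      exact hodd q hq hq2 hqN
    obtain ⟨ha, hb⟩ := DefiniteXiPolyFreyDegree.natAbs_le_two hab
      (DefiniteXiPolyFreyDegree.prime_eq_two_of_dvd hab h0 hN hno)
    have hle : (((freyCurve a b).minimalDiscriminantNorm ℤ : ℕ) : ℝ) ≤ 4096 := by
      have h1 := (minimalDiscriminantNorm_freyCurve_le h0).trans (sixteen_mul_sq_le ha hb)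
      exact_mod_cast h1
    calc (((freyCurve a b).minimalDiscriminantNorm ℤ : ℕ) : ℝ) ≤ 4096 := hle
      _ ≤ (M ^ 2 + 4096) * 1 := by nlinarith [sq_nonneg M]
      _ ≤ (M ^ 2 + 4096) * (N : ℝ) ^ (12 * A') :=
          mul_le_mul_of_nonneg_left hNκ1 (by positivity)

end Summit.ABC.ABC.Theorems

end
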